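import Literature.Barriers.PneNP.TSPExtensionComplexityFactorization
import Literature.Barriers.PneNP.TSPExtensionComplexityFaces
import Literature.Combinatorics.Optimization.LPRelaxationsMaxCSP
import HarnessLib

/-!
# Yannakakis' factorization theorem for nested pairs (Braun–Fiorini–Pokutta–Steurer 2012, Theorem 1; Fawzi 2021, Theorem 4)

Topic `Literature/Barriers/PneNP` (home of `HasEFOfSize`).  Source read: G. Braun, S. Fiorini,
S. Pokutta, D. Steurer, *Approximation Limits of Linear Programs (Beyond Hierarchies)*, FOCS 2012 =
arXiv:1204.0957 [BraunEtAl2012], §2.3 (held text `paper:arxiv-1204.0957`, p. 6–7):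

«An extended formulation (EF) of the pair `P,Q` is a system `Ex + Fy = g, y ≥ 0` defining a polyhedron
`K := {x ∈ ℝ^d | Ex + Fy = g, y ≥ 0}` such that `P ⊆ K ⊆ Q`. We denote by `xc(P,Q)` the minimum size
of an EF of the pair `P,Q`.  Now consider an inner description `P := conv{v_1,…,v_n} + cone{r_1,…,r_k}`
of `P` and an outer description `Q := {x ∈ ℝ^d | Ax ≤ b}` … The slack matrix of the pair `P,Q` … is the
`m × (n + k)` matrix … `S_vertex(i,j) := b_i − A_i v_j`, `S_ray(i,j) := −A_i r_j`.
**Theorem 1.** With the above notations, we have `nnegrk(S^{P,Q}) − 1 ≤ xc(P,Q) ≤ nnegrk(S^{P,Q})` for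
every slack matrix of the pair `P,Q`.»  Printed proof of the upper bound (p. 7): "let `S^{P,Q} = TU` …
Consider the system `Ax + Ty = b, y ≥ 0` and the corresponding polyhedron `K` … The inclusion
`K ⊆ Q` simply follows from `Ty ≥ 0`. For the inclusion `P ⊆ K`, pick a vertex `v_j` of `P` and observe
that `(x,y) = (v_j, U^j_vertex)` satisfies [the system] … Similarly, for every ray `r_j` we obtain a
ray `(r_j, U^j_ray)` of `K`."  The same statement (for two convex bodies, both directions) is Theorem 4
("Generalized Yannakakis theorem") of [Fawzi2021], §2.2, p. 5, attributed there to Yannakakis and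
Pashkovich.

THIS FILE, in the tree's slack-form currency `HasEFOfSize` (size = number of sign-constrained
variables), with the inner description given by families of points `v : J → ℝ^ι` and rays
`ρ : R → ℝ^ι` and the outer description by finitely many inequalities `c_a · x ≤ d_a`:

* `BraunEtAl2012_thm1_upper` — **`xc(P,Q) ≤ nnegrk(S^{P,Q})`**: a nonnegative factorization of the
  vertex-and-ray slack matrix through `Fin r` produces `K = {x | ∃ y ≥ 0, c_a·x + ∑_l T_{al} y_l = d_a}`
  with every `v_j ∈ K`, `K` closed under adding the rays, `K ⊆ Q`, `K` convex, and `HasEFOfSize K r`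
  (PROVED, the printed construction); `BraunEtAl2012_thm1_upper_convexHull` packages
  `conv(v) ⊆ K ⊆ Q`.
* `BraunEtAl2012_thm1_lower` — **`nnegrk(S_vertex) − 1 ≤ xc(P,Q)`**: if some `K` with all `v_j ∈ K`
  and `K ⊆ Q` has `HasEFOfSize K r`, the vertex slack matrix has a nonnegative factorization of size
  `r + 1` (the tree's `HasEFOfSize.exists_nonneg_factorisation`, which is exactly the printed LP-duality
  argument; the ray block of the lower bound is not treated — `TODO(general form): ray columns`).

All statements are theorems; no definitions, no named facts.  First consumers: the polyhedral
approximation theorems of [Fawzi2021] (`Literature/Combinatorics/Optimization/DensityMatricesPolyhedralApproximation.lean`,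
which uses the lower half) and the BFPS sandwich facts `BFPS2012_corSandwichHard` /
`BraunEtAl2015_corSandwichXC`, whose printed proof route is Theorem 1 + Theorem 5.
-/

noncomputable section

namespace Literature.Barriers.PneNP

open Matrix Finset
open Literature.Combinatorics.Optimization (HasNonnegFactorization)

variable {ι : Type} [Fintype ι]

/-! ### The upper bound: a factorization gives an EF of the pair -/

/-- **BFPS 2012, Theorem 1, upper bound `xc(P,Q) ≤ nnegrk(S^{P,Q})`** (the printed construction).
Given points `v_j`, rays `ρ_k`, inequalities `c_a · x ≤ d_a` and nonnegative matrices `T` (`A × r`),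
`U` (`r × J`), `W` (`r × R`) with `d_a − c_a·v_j = ∑_l T_{al} U_{lj}` and `−c_a·ρ_k = ∑_l T_{al} W_{lk}`,
the polyhedron `K = {x | ∃ y ≥ 0, ∀ a, c_a·x + ∑_l T_{al} y_l = d_a}` contains every `v_j`, is closed
under `x ↦ x + t ρ_k` (`t ≥ 0`), is contained in `Q = {x | ∀ a, c_a·x ≤ d_a}`, is convex, and has a
slack-form extended formulation of size `r`. [cite: BraunEtAl2012, Thm. 1 (§2.3, arXiv p. 7)]
[cite: Fawzi2021, Thm. 4 (§2.2, p. 5)] -/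
theorem BraunEtAl2012_thm1_upper {A J R : Type} [Fintype A] {r : ℕ} (v : J → ι → ℝ) (ρ : R → ι → ℝ)
    (c : A → ι → ℝ) (d : A → ℝ) (T : A → Fin r → ℝ) (U : Fin r → J → ℝ) (W : Fin r → R → ℝ)
    (hT : ∀ a l, 0 ≤ T a l) (hU : ∀ l j, 0 ≤ U l j) (hW : ∀ l k, 0 ≤ W l k)
    (hvert : ∀ a j, d a - c a ⬝ᵥ v j = ∑ l, T a l * U l j)
    (hray : ∀ a k, -(c a ⬝ᵥ ρ k) = ∑ l, T a l * W l k) :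
    ∃ K : Set (ι → ℝ), (∀ j, v j ∈ K) ∧ (∀ x ∈ K, ∀ k, ∀ t : ℝ, 0 ≤ t → x + t • ρ k ∈ K) ∧
      (∀ x ∈ K, ∀ a, c a ⬝ᵥ x ≤ d a) ∧ Convex ℝ K ∧ HasEFOfSize K r := by
  classical
  -- the system `C x + T y = d`, rows indexed by `A`, slack variables by `Fin r`
  let C : Matrix A ι ℝ := Matrix.of fun a i => c a i
  let Tm : Matrix A (Fin r) ℝ := Matrix.of fun a l => T a l
  let K : Set (ι → ℝ) := {x | ∃ y : Fin r → ℝ, (∀ l, 0 ≤ y l) ∧ C *ᵥ x + Tm *ᵥ y = d}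
  have hCx : ∀ x : ι → ℝ, ∀ a, (C *ᵥ x) a = c a ⬝ᵥ x := fun x a => rfl
  have hTy : ∀ y : Fin r → ℝ, ∀ a, (Tm *ᵥ y) a = ∑ l, T a l * y l := fun y a => rfl
  have hmem : ∀ x : ι → ℝ, x ∈ K ↔ ∃ y : Fin r → ℝ, (∀ l, 0 ≤ y l) ∧ ∀ a, c a ⬝ᵥ x + ∑ l, T a l * y l = d a := by
    intro x
    simp only [K, Set.mem_setOf_eq]
    constructor
    · rintro ⟨y, hy, h⟩
      exact ⟨y, hy, fun a => by have := congrFun h a; rwa [Pi.add_apply, hCx, hTy] at this⟩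
    · rintro ⟨y, hy, h⟩
      exact ⟨y, hy, funext fun a => by rw [Pi.add_apply, hCx, hTy]; exact h a⟩
  refine ⟨K, ?_, ?_, ?_, ?_, ?_⟩
  · -- vertices: `(v_j, U^j)` solves the system
    intro j
    rw [hmem]
    refine ⟨fun l => U l j, fun l => hU l j, fun a => ?_⟩
    have := hvert a j
    linarith
  · -- rays: `(x + t ρ_k, y + t W^k)` solves the system
    intro x hx k t ht
    rw [hmem] at hx ⊢
    obtain ⟨y, hy, h⟩ := hx
    refine ⟨fun l => y l + t * W l k, fun l => add_nonneg (hy l) (mul_nonneg ht (hW l k)), fun a => ?_⟩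
    have h1 := h a
    have h2 := hray a k
    have e : ∑ l, T a l * (y l + t * W l k) = ∑ l, T a l * y l + t * ∑ l, T a l * W l k := by
      rw [mul_sum, ← sum_add_distrib]
      exact sum_congr rfl fun l _ => by ring
    rw [dotProduct_add, dotProduct_smul, smul_eq_mul, e, ← h2]
    linarith
  · -- `K ⊆ Q`: `c_a x = d_a − ∑_l T_{al} y_l ≤ d_a`
    intro x hx a
    rw [hmem] at hx
    obtain ⟨y, hy, h⟩ := hx
    have h0 : 0 ≤ ∑ l, T a l * y l := sum_nonneg fun l _ => mul_nonneg (hT a l) (hy l)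
    linarith [h a]
  · -- convexity
    intro x hx z hz α β hα hβ hαβ
    rw [hmem] at hx hz ⊢
    obtain ⟨y, hy, hxy⟩ := hx
    obtain ⟨w, hw, hzw⟩ := hz
    refine ⟨fun l => α * y l + β * w l, fun l => add_nonneg (mul_nonneg hα (hy l)) (mul_nonneg hβ (hw l)),
      fun a => ?_⟩
    have e : ∑ l, T a l * (α * y l + β * w l) = α * ∑ l, T a l * y l + β * ∑ l, T a l * w l := by
      rw [mul_sum, mul_sum, ← sum_add_distrib]
      exact sum_congr rfl fun l _ => by ring
    rw [dotProduct_add, dotProduct_smul, dotProduct_smul, smul_eq_mul, smul_eq_mul, e]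
    have h1 := hxy a
    have h2 := hzw a
    have : α * (c a ⬝ᵥ x + ∑ l, T a l * y l) + β * (c a ⬝ᵥ z + ∑ l, T a l * w l) = (α + β) * d a := by
      rw [h1, h2]; ring
    rw [hαβ, one_mul] at this
    linarith
  · -- the system is a slack-form EF of size `r`
    have h := hasEFOfSize_of_system (ι := ι) C Tm d
    rwa [Fintype.card_fin] at h

/-- The upper bound packaged for polytopes: `conv{v_j} ⊆ K ⊆ {x | c_a·x ≤ d_a ∀ a}` with
`HasEFOfSize K r`, from a size-`r` nonnegative factorization of the vertex slack matrix
`d_a − c_a·v_j` (no rays). [cite: BraunEtAl2012, Thm. 1 (§2.3, arXiv p. 7)] [cite: Fawzi2021, Thm. 4 (§2.2, p. 5)] -/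
theorem BraunEtAl2012_thm1_upper_convexHull {A J : Type} [Fintype A] {r : ℕ} (v : J → ι → ℝ)
    (c : A → ι → ℝ) (d : A → ℝ)
    (hfac : HasNonnegFactorization (fun a j => d a - c a ⬝ᵥ v j) r) :
    ∃ K : Set (ι → ℝ), convexHull ℝ (Set.range v) ⊆ K ∧ K ⊆ {x | ∀ a, c a ⬝ᵥ x ≤ d a} ∧
      HasEFOfSize K r := by
  obtain ⟨T, U, hT, hU, h⟩ := hfac
  obtain ⟨K, hv, -, hQ, hconv, hEF⟩ := BraunEtAl2012_thm1_upper (R := Empty) v (fun k => k.elim) c d T U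
    (fun _ k => k.elim) hT hU (fun _ k => k.elim) h (fun _ k => k.elim)
  refine ⟨K, ?_, fun x hx a => hQ x hx a, hEF⟩
  exact convexHull_min (Set.range_subset_iff.2 hv) hconv

/-! ### The lower bound: an EF of the pair gives a factorization of the vertex slack matrix -/

/-- **BFPS 2012, Theorem 1, lower bound `nnegrk(S^{P,Q}_vertex) ≤ xc(P,Q) + 1`**: if `K` contains the
points `v_j`, satisfies the inequalities `c_a·x ≤ d_a`, and has a slack-form extended formulation with
`r` inequalities, then the vertex slack matrix `d_a − c_a·v_j` has a nonnegative factorization of size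
`r + 1` (LP duality: the tree's `HasEFOfSize.exists_nonneg_factorisation`).  The ray block is not
treated here (`TODO(general form)`: ray columns `−c_a·ρ_k`).
[cite: BraunEtAl2012, Thm. 1 (§2.3, arXiv p. 7)] [cite: Fawzi2021, Thm. 4 (§2.2, p. 5)] -/
theorem BraunEtAl2012_thm1_lower {A J : Type} {r : ℕ} {K : Set (ι → ℝ)} (hK : HasEFOfSize K r)
    (v : J → ι → ℝ) (hv : ∀ j, v j ∈ K) (c : A → ι → ℝ) (d : A → ℝ)
    (hvalid : ∀ a, ∀ x ∈ K, c a ⬝ᵥ x ≤ d a) :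
    HasNonnegFactorization (fun a j => d a - c a ⬝ᵥ v j) (r + 1) := by
  obtain ⟨U, V, hU, hV, h⟩ := hK.exists_nonneg_factorisation v hv c d hvalid
  refine ⟨fun a l => U a (finSuccEquiv r l), fun l j => V (finSuccEquiv r l) j, fun a l => hU _ _,
    fun l j => hV _ _, fun a j => ?_⟩
  simp only
  rw [h a j]
  exact (Fintype.sum_equiv (finSuccEquiv r) _ _ fun l => rfl).symm

/-- **Theorem 1, both halves, for a sandwiched pair given by points and inequalities**:
`min {r : some K with conv(v) ⊆ K ⊆ Q has HasEFOfSize K r}` is squeezed between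
`nnegrk(S_vertex) − 1` and `nnegrk(S_vertex)`.  Stated as the two implications.
[cite: BraunEtAl2012, Thm. 1 (§2.3, arXiv p. 7)] -/
theorem BraunEtAl2012_thm1 {A J : Type} [Fintype A] {r : ℕ} (v : J → ι → ℝ) (c : A → ι → ℝ) (d : A → ℝ) :
    (HasNonnegFactorization (fun a j => d a - c a ⬝ᵥ v j) r →
      ∃ K : Set (ι → ℝ), convexHull ℝ (Set.range v) ⊆ K ∧ K ⊆ {x | ∀ a, c a ⬝ᵥ x ≤ d a} ∧
        HasEFOfSize K r) ∧
    ((∃ K : Set (ι → ℝ), convexHull ℝ (Set.range v) ⊆ K ∧ K ⊆ {x | ∀ a, c a ⬝ᵥ x ≤ d a} ∧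
        HasEFOfSize K r) → HasNonnegFactorization (fun a j => d a - c a ⬝ᵥ v j) (r + 1)) := by
  refine ⟨BraunEtAl2012_thm1_upper_convexHull v c d, ?_⟩
  rintro ⟨K, hP, hQ, hK⟩
  exact BraunEtAl2012_thm1_lower hK v (fun j => hP (subset_convexHull ℝ _ (Set.mem_range_self j))) c d
    (fun a x hx => hQ hx a)

end Literature.Barriers.PneNP

end
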